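import Summits.Parity.GeneralizedHardyLittlewood.Theorems.PrimeLevelFamEdgeMomentsBeyondDiagonalDiagRemFourFourInnerHolds
import Summits.Parity.GeneralizedHardyLittlewood.Theorems.PrimeLevelFamEdgeMomentsBeyondDiagonalDiagRemAssembly
import HarnessLib

/-!
# Route `PrimeLevelFamEdge`, crux K_A `MomentsBeyondDiagonal` (stmt-Parity-20007), line «petersson_layers» v4, stub `stub_diag`:
# **the inner `(k₁,k₂)` estimate of (R₄₄) IN SELBERG COORDINATES** (brick B5a of the order-`(4,4)` remainder estimate)

`…DiagRemFourFourInnerHolds.abs_inner_rem_le₄₄` (lineage famedge-1 g17, p840663) is the inner estimate of (R₄₄) in the abstract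
coordinates `(Y, α, β, Λ, L)`. This file moves it to the coordinates in which the hypothesis `hR` of
`…DiagOrderFourFourOfR44.orderFourFour_target_of_remainder` is written — `Y = M/n`, `α = g²/Q²`, `β = log Q − log g − log Y`,
`L = log M`, `Λ = 1 + 2log M + log Q` (so `2β + ℓ⁺(k₁) + ℓ⁺(k₂) = 2(log Q − log g) − log k₁ − log k₂`, `αk₁k₂ = g²k₁k₂/Q²`,
`1/(αk₁k₂) = Q²/(g²k₁k₂)`), with the envelope `x¹⁰ ≤ 2¹⁰Λ¹⁰` (`x = 1 + |log(2αY²)| ≤ 2Λ`) absorbed: the shape of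
`…DiagRemTwoFourInner.abs_inner_rem_le₂₄` (envelope exponent `20`, saving exponent `16`), which is what the `(c,g)` bookkeeping
`…DiagRemOuterPow.per_term_bound_gen_pow 16` / `final_arith_pow (e := 20) (A := 16) (b := 5)` consumes. It also records the
generic form of the `τ ↦ a_n` rewriting of the Selberg remainder summand (`…DiagRemAssembly.prefactor_aux` for an ARBITRARY weight),
so that the (R₄₄) assembly needs no 50-kB restatement of the weight.

* `selbergRem_inner_eq_weight` — for any weight `w(k₁,k₂)`: `Σ_{k₁,k₂≤⌊M⌋/n} y_{nk₁}y_{nk₂}·τ(k₁)τ(k₂)·w = W(n)²·Σ_{k₁,k₂≤M/n}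
  a_n(k₁)P(ℓ⁺₁/log M)a_n(k₂)P(ℓ⁺₂/log M)·w` (`y_m = μ(m)ψ(m)⁻¹P(log(M/m)/log M)/m`);
* `abs_inner_rem_selberg_le₄₄` — **the inner estimate of (R₄₄) in Selberg coordinates**: for `n, g ≥ 1`, `Q, M ≥ 2`, `n, g ≤ M`,
  `2(g²/Q²)K₁(M/n) ≤ 1`: `|Σ_{k₁,k₂≤M/n} a_n(k₁)P(ℓ⁺₁/log M)a_n(k₂)P(ℓ⁺₂/log M)·Wt₄₄(k₁,k₂)| ≤ C·D(n)²·Λ²⁰·(√(2(g²/Q²)K₁(M/n)) + (1+log K₁)⁻¹⁶)`,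
  the weight `Wt₄₄` written exactly as in `hR` (level `Q`, mollifier length `M`).

Def-free; theorems only. Helper `--supports stmt-Parity-20007`; closes nothing (the outer `(c,g)` sum = (R₄₄) proper, the order-(4,4)
target and rung 4 are filed next; `stub_diag` quantifies over every `Q`; `stub_rung/core/band/farP` remain); K_A, K_B and the
Parity summit are NOT proved; nothing about Landau–Siegel zeros.

## References
* E. Kowalski, P. Michel, J. VanderKam, J. reine angew. Math. 526 (2000), (23)–(28) pp. 13–15 and Prop. 5.1 p. 18.
  [cite: KowalskiMichelVanderKam2000, (23)–(28) and Prop. 5.1 — derivation (order-(4,4) remainder, inner sums, Selberg coordinates)]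
-/

noncomputable section

open scoped Real ArithmeticFunction.Moebius
open Finset ArithmeticFunction Polynomial Real MeasureTheory
open Set (Ioi)

namespace Summit.Parity.GeneralizedHardyLittlewood.Theorems.MomentsBeyondDiagonal.DiagCorner

open Literature.NumberTheory.LFunctions Literature.NumberTheory.LFunctions.KMV2000
open MollifierMainTerm (W)
open Summit.Parity.GeneralizedHardyLittlewood.Theorems.BeyondDiagonalBeatsQuarter.KernelFormXSq
  (copTauW copTauW_apply divWeight divWeight_nonneg one_le_divWeight abs_W_le)
open Summit.Parity.GeneralizedHardyLittlewood.Theorems.BeyondDiagonalBeatsQuarter.Corner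

/-! ### The Selberg remainder summand for an arbitrary weight -/

/-- **`τ ↦ a_n` for an arbitrary weight**: for `n ≥ 1`, `M > 0` and any `w`,
`Σ_{k₁,k₂ ≤ ⌊M⌋/n} y_{nk₁}·y_{nk₂}·(τ(k₁)τ(k₂)·w(k₁,k₂)) = W(n)²·Σ_{k₁,k₂ ≤ M/n} a_n(k₁)P(ℓ⁺(k₁)/log M)·(a_n(k₂)P(ℓ⁺(k₂)/log M))·w(k₁,k₂)`
with `y_m = μ(m)ψ(m)⁻¹P(log(M/m)/log M)/m`, `a_n = copTauW n`, `ℓ⁺ = ellp (M/n)` (`…DiagRemAssembly.prefactor_aux` summed).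
[cite: KowalskiMichelVanderKam2000, (23) — derivation] -/
theorem selbergRem_inner_eq_weight (P : ℝ[X]) {M : ℝ} (hM : 0 < M) {n : ℕ} (hn : n ≠ 0) (w : ℕ → ℕ → ℝ) :
    ∑ k₁ ∈ Icc 1 (⌊M⌋₊ / n), ∑ k₂ ∈ Icc 1 (⌊M⌋₊ / n),
      ((μ (n * k₁) : ℝ) * ((psi (n * k₁))⁻¹ *
          P.eval (Real.log (M / ((n * k₁ : ℕ) : ℝ)) / Real.log M)) / ((n * k₁ : ℕ) : ℝ)) *
        ((μ (n * k₂) : ℝ) * ((psi (n * k₂))⁻¹ *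
          P.eval (Real.log (M / ((n * k₂ : ℕ) : ℝ)) / Real.log M)) / ((n * k₂ : ℕ) : ℝ)) *
        ((k₁.divisors.card : ℝ) * (k₂.divisors.card : ℝ) * w k₁ k₂) =
    W n ^ 2 * ∑ k₁ ∈ Icc 1 ⌊M / (n : ℝ)⌋₊, ∑ k₂ ∈ Icc 1 ⌊M / (n : ℝ)⌋₊,
      copTauW n k₁ * P.eval (ellp (M / (n : ℝ)) k₁ / Real.log M) *
        (copTauW n k₂ * P.eval (ellp (M / (n : ℝ)) k₂ / Real.log M)) * w k₁ k₂ := by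
  have hY0 : 0 ≤ M / (n : ℝ) := by positivity
  rw [Nat.floor_div_natCast, Finset.mul_sum]
  refine Finset.sum_congr rfl fun k₁ hk₁ ↦ ?_
  rw [Finset.mul_sum]
  refine Finset.sum_congr rfl fun k₂ hk₂ ↦ ?_
  have hk₁0 : k₁ ≠ 0 := by have := (Finset.mem_Icc.1 hk₁).1; omega
  have hk₂0 : k₂ ≠ 0 := by have := (Finset.mem_Icc.1 hk₂).1; omega
  have hk₁' : k₁ ∈ Icc 1 ⌊M / (n : ℝ)⌋₊ := by rwa [Nat.floor_div_natCast]
  have hk₂' : k₂ ∈ Icc 1 ⌊M / (n : ℝ)⌋₊ := by rwa [Nat.floor_div_natCast]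
  rw [ellp_eq_log hY0 hk₁', ellp_eq_log hY0 hk₂']
  exact prefactor_aux (tau_mul_xP_div P M hn hk₁0) (tau_mul_xP_div P M hn hk₂0)

/-! ### The inner estimate in Selberg coordinates -/

set_option maxHeartbeats 12000000 in
set_option maxRecDepth 20000 in
-- large statement (the order-(4,4) remainder weight verbatim); one coordinate rewriting of a 24-kB sum against `abs_inner_rem_le₄₄ 16`
/-- **The inner `(k₁,k₂)` estimate of (R₄₄) in Selberg coordinates** (see the module docstring): the shape of
`…DiagRemTwoFourInner.abs_inner_rem_le₂₄` with envelope `Λ²⁰` and saving `(1+log K₁)⁻¹⁶`.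
[cite: KowalskiMichelVanderKam2000, (23)–(28) and Prop. 5.1 — derivation (order-(4,4) remainder, inner sums, Selberg coordinates)] -/
theorem abs_inner_rem_selberg_le₄₄ : ∃ E₀₀ E₀₁ E₀₂ E₀₃ E₀₄ E₁₀ E₁₁ E₁₂ E₁₃ E₁₄ E₂₀ E₂₁ E₂₂ E₂₃ E₂₄ E₃₀ E₃₁ E₃₂ E₃₃ E₃₄ E₄₀ E₄₁ E₄₂ E₄₃ E₄₄ μ₂ μ₄ μ₆ μ₈ : ℝ, ∀ P : ℝ[X], P.coeff 0 = 0 → ∃ C : ℝ, 0 < C ∧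
    ∀ (n g : ℕ), n ≠ 0 → g ≠ 0 → ∀ (Q M : ℝ), 2 ≤ Q → 2 ≤ M → (n : ℝ) ≤ M → (g : ℝ) ≤ M → ∀ K₁ : ℕ,
      2 * ((g : ℝ) ^ 2 / Q ^ 2) * K₁ * (M / n) ≤ 1 →
    |∑ k₁ ∈ Icc 1 ⌊M / (n : ℝ)⌋₊, ∑ k₂ ∈ Icc 1 ⌊M / (n : ℝ)⌋₊,
        copTauW n k₁ * P.eval (ellp (M / (n : ℝ)) k₁ / Real.log M) *
          (copTauW n k₂ * P.eval (ellp (M / (n : ℝ)) k₂ / Real.log M)) *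
          
            (((2 * (Real.log Q - Real.log g) - Real.log k₁ - Real.log k₂) ^ (8 : ℕ) - 4 * (2 * (Real.log Q - Real.log g) - Real.log k₁ - Real.log k₂) ^ (6 : ℕ) * ((∑ p ∈ k₁.primeFactors, Real.log p ^ (2 : ℕ)) + ∑ p ∈ k₂.primeFactors, Real.log p ^ (2 : ℕ)) + 18 * (2 * (Real.log Q - Real.log g) - Real.log k₁ - Real.log k₂) ^ (4 : ℕ) * ((∑ p ∈ k₁.primeFactors, Real.log p ^ (2 : ℕ)) + ∑ p ∈ k₂.primeFactors, Real.log p ^ (2 : ℕ)) ^ (2 : ℕ) - 60 * (2 * (Real.log Q - Real.log g) - Real.log k₁ - Real.log k₂) ^ (2 : ℕ) * ((∑ p ∈ k₁.primeFactors, Real.log p ^ (2 : ℕ)) + ∑ p ∈ k₂.primeFactors, Real.log p ^ (2 : ℕ)) ^ (3 : ℕ) - 12 * (2 * (Real.log Q - Real.log g) - Real.log k₁ - Real.log k₂) ^ (4 : ℕ) * ((∑ p ∈ k₁.primeFactors, Real.log p ^ (4 : ℕ)) + ∑ p ∈ k₂.primeFactors, Real.log p ^ (4 : ℕ)) + 120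 * (2 * (Real.log Q - Real.log g) - Real.log k₁ - Real.log k₂) ^ (2 : ℕ) * ((∑ p ∈ k₁.primeFactors, Real.log p ^ (2 : ℕ)) +
            ∑ p ∈ k₂.primeFactors, Real.log p ^ (2 : ℕ)) * ((∑ p ∈ k₁.primeFactors, Real.log p ^ (4 : ℕ)) + ∑ p ∈ k₂.primeFactors, Real.log p ^ (4 : ℕ)) + 105 * ((∑ p ∈ k₁.primeFactors, Real.log p ^ (2 : ℕ)) + ∑ p ∈ k₂.primeFactors, Real.log p ^ (2 : ℕ)) ^ (4 : ℕ) - 64 * (2 * (Real.log Q - Real.log g) - Real.log k₁ - Real.log k₂) ^ (2 : ℕ) * ((∑ p ∈ k₁.primeFactors, Real.log p ^ (6 : ℕ)) + ∑ p ∈ k₂.primeFactors, Real.log p ^ (6 : ℕ)) - 420 * ((∑ p ∈ k₁.primeFactors, Real.log p ^ (2 : ℕ)) + ∑ p ∈ k₂.primeFactors, Real.log p ^ (2 : ℕ)) ^ (2 : ℕ) * ((∑ p ∈ k₁.primeFactors, Real.log p ^ (4 : ℕ)) + ∑ p ∈ k₂.primeFactors, Real.log p ^ (4 : ℕ)) +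 448 * ((∑ p ∈ k₁.primeFactors, Real.log p ^ (2 : ℕ)) + ∑ p ∈ k₂.primeFactors, Real.log p ^ (2 : ℕ)) * ((∑ p ∈ k₁.primeFactors, Real.log p ^ (6 : ℕ)) + ∑ p ∈ k₂.primeFactors, Real.log p ^ (6 : ℕ)) + 140 * ((∑ p ∈ k₁.primeFactors, Real.log p ^ (4 : ℕ)) + ∑ p ∈ k₂.primeFactors, Real.log p ^ (4 : ℕ)) ^ (2 : ℕ) - 272 *
            ((∑ p ∈ k₁.primeFactors, Real.log p ^ (8 : ℕ)) + ∑ p ∈ k₂.primeFactors, Real.log p ^ (8 : ℕ))) / 256 * ((∫ u₁ in Ioi (0 : ℝ), ∫ u₂ in Ioi ((((g * g * (k₁ * k₂) : ℕ) : ℝ) / Q ^ (2 : ℕ)) / u₁), Real.exp (-(u₁ + u₂)) / (1 - Real.exp (-(u₁ + u₂))) ^ (2 : ℕ)) - (Real.log (Q ^ (2 : ℕ) / ((g * g * (k₁ * k₂) : ℕ) : ℝ)) / 2 + E₀₀)) +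
            ((2 * (Real.log Q - Real.log g) - Real.log k₁ - Real.log k₂) ^ (7 : ℕ) - 3 * (2 * (Real.log Q - Real.log g) - Real.log k₁ - Real.log k₂) ^ (5 : ℕ) * ((∑ p ∈ k₁.primeFactors, Real.log p ^ (2 : ℕ)) + ∑ p ∈ k₂.primeFactors, Real.log p ^ (2 : ℕ)) + 9 * (2 * (Real.log Q - Real.log g) - Real.log k₁ - Real.log k₂) ^ (3 : ℕ) * ((∑ p ∈ k₁.primeFactors, Real.log p ^ (2 : ℕ)) + ∑ p ∈ k₂.primeFactors, Real.log p ^ (2 : ℕ)) ^ (2 : ℕ) - 15 * (2 * (Real.log Q - Real.log g) - Real.log k₁ - Real.log k₂) * ((∑ p ∈ k₁.primeFactors, Real.log p ^ (2 : ℕ)) + ∑ p ∈ k₂.primeFactors, Real.log p ^ (2 : ℕ)) ^ (3 : ℕ) - 6 * (2 * (Real.log Q - Real.log g) - Real.log k₁ - Real.log k₂) ^ (3 : ℕ) * ((∑ p ∈ k₁.primeFactors, Real.log p ^ (4 : ℕ)) + ∑ p ∈ k₂.primeFactors, Real.log p ^ (4 : ℕ)) + 30 * (2 * (Real.log Q -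 Real.log g) - Real.log k₁ - Real.log k₂) * ((∑ p ∈ k₁.primeFactors, Real.log p ^ (2 : ℕ)) + ∑ p ∈ k₂.primeFactors, Real.log p ^ (2 : ℕ)) *
            ((∑ p ∈ k₁.primeFactors, Real.log p ^ (4 : ℕ)) + ∑ p ∈ k₂.primeFactors, Real.log p ^ (4 : ℕ)) - 16 * (2 * (Real.log Q - Real.log g) - Real.log k₁ - Real.log k₂) * ((∑ p ∈ k₁.primeFactors, Real.log p ^ (6 : ℕ)) + ∑ p ∈ k₂.primeFactors, Real.log p ^ (6 : ℕ))) / 32 * ((∫ u₁ in Ioi (0 : ℝ), ∫ u₂ in Ioi ((((g * g * (k₁ * k₂) : ℕ) : ℝ) / Q ^ (2 : ℕ)) / u₁), Real.exp (-(u₁ + u₂)) / (1 - Real.exp (-(u₁ + u₂))) ^ (2 : ℕ) * Real.log u₂) - (-(Real.log (Q ^ (2 : ℕ) / ((g * g * (k₁ * k₂) : ℕ) : ℝ)) ^ (2 : ℕ)) / 8 + E₀₁)) +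
            (3 * (2 * (Real.log Q - Real.log g) - Real.log k₁ - Real.log k₂) ^ (6 : ℕ) - 3 * (2 * (Real.log Q - Real.log g) - Real.log k₁ - Real.log k₂) ^ (4 : ℕ) * ((∑ p ∈ k₁.primeFactors, Real.log p ^ (2 : ℕ)) + ∑ p ∈ k₂.primeFactors, Real.log p ^ (2 : ℕ)) - 9 * (2 * (Real.log Q - Real.log g) - Real.log k₁ - Real.log k₂) ^ (2 : ℕ) * ((∑ p ∈ k₁.primeFactors, Real.log p ^ (2 : ℕ)) + ∑ p ∈ k₂.primeFactors, Real.log p ^ (2 : ℕ)) ^ (2 : ℕ) + 6 * (2 * (Real.log Q - Real.log g) - Real.log k₁ - Real.log k₂) ^ (2 : ℕ) * ((∑ p ∈ k₁.primeFactors, Real.log p ^ (4 : ℕ)) + ∑ p ∈ k₂.primeFactors, Real.log p ^ (4 : ℕ)) + 45 * ((∑ p ∈ k₁.primeFactors, Real.log p ^ (2 : ℕ)) + ∑ p ∈ k₂.primeFactors, Real.log p ^ (2 : ℕ)) ^ (3 : ℕ) - 90 * ((∑ p ∈ k₁.primeFactors, Real.log p ^ (2 : ℕ)) + ∑ p ∈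 k₂.primeFactors, Real.log p ^ (2 : ℕ)) * ((∑ p ∈ k₁.primeFactors, Real.log p ^ (4 : ℕ)) + ∑ p ∈ k₂.primeFactors, Real.log p ^ (4 : ℕ)) + 48 *
            ((∑ p ∈ k₁.primeFactors, Real.log p ^ (6 : ℕ)) + ∑ p ∈ k₂.primeFactors, Real.log p ^ (6 : ℕ))) / 32 * ((∫ u₁ in Ioi (0 : ℝ), ∫ u₂ in Ioi ((((g * g * (k₁ * k₂) : ℕ) : ℝ) / Q ^ (2 : ℕ)) / u₁), Real.exp (-(u₁ + u₂)) / (1 - Real.exp (-(u₁ + u₂))) ^ (2 : ℕ) * Real.log u₂ ^ (2 : ℕ)) - (Real.log (Q ^ (2 : ℕ) / ((g * g * (k₁ * k₂) : ℕ) : ℝ)) ^ (3 : ℕ) / 24 + 2 * μ₂ * Real.log (Q ^ (2 : ℕ) / ((g * g * (k₁ * k₂) : ℕ) : ℝ)) + E₀₂)) +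
            ((2 * (Real.log Q - Real.log g) - Real.log k₁ - Real.log k₂) ^ (5 : ℕ) + 2 * (2 * (Real.log Q - Real.log g) - Real.log k₁ - Real.log k₂) ^ (3 : ℕ) * ((∑ p ∈ k₁.primeFactors, Real.log p ^ (2 : ℕ)) + ∑ p ∈ k₂.primeFactors, Real.log p ^ (2 : ℕ)) - 9 * (2 * (Real.log Q - Real.log g) - Real.log k₁ - Real.log k₂) * ((∑ p ∈ k₁.primeFactors, Real.log p ^ (2 : ℕ)) + ∑ p ∈ k₂.primeFactors, Real.log p ^ (2 : ℕ)) ^ (2 : ℕ) + 6 * (2 * (Real.log Q - Real.log g) - Real.log k₁ - Real.log k₂) * ((∑ p ∈ k₁.primeFactors, Real.log p ^ (4 : ℕ)) + ∑ p ∈ k₂.primeFactors, Real.log p ^ (4 : ℕ))) / 8 * ((∫ u₁ in Ioi (0 : ℝ), ∫ u₂ in Ioi ((((g * g * (k₁ * k₂) : ℕ) : ℝ) / Q ^ (2 : ℕ)) / u₁), Real.exp (-(u₁ + u₂)) / (1 - Real.exp (-(u₁ + u₂))) ^ (2 : ℕ) * Real.log u₂ ^ (3 : ℕ)) - (-(Real.log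 (Q ^ (2 : ℕ) / ((g * g * (k₁ * k₂) : ℕ) : ℝ)) ^ (4 : ℕ)) / 64 - 3 * μ₂ / 2 * Real.log (Q ^ (2 : ℕ) / ((g * g * (k₁ * k₂) : ℕ) : ℝ)) ^ (2 : ℕ) + E₀₃)) +
            ((2 * (Real.log Q - Real.log g) - Real.log k₁ - Real.log k₂) ^ (4 : ℕ) + 6 * (2 * (Real.log Q - Real.log g) - Real.log k₁ - Real.log k₂) ^ (2 : ℕ) * ((∑ p ∈ k₁.primeFactors, Real.log p ^ (2 : ℕ)) + ∑ p ∈ k₂.primeFactors, Real.log p ^ (2 : ℕ)) + 3 * ((∑ p ∈ k₁.primeFactors, Real.log p ^ (2 : ℕ)) + ∑ p ∈ k₂.primeFactors, Real.log p ^ (2 : ℕ)) ^ (2 : ℕ) - 2 * ((∑ p ∈ k₁.primeFactors, Real.log p ^ (4 : ℕ)) + ∑ p ∈ k₂.primeFactors, Real.log p ^ (4 : ℕ))) / 16 * ((∫ u₁ in Ioi (0 : ℝ), ∫ u₂ in Ioi ((((g * g * (k₁ * k₂) : ℕ) : ℝ) / Q ^ (2 : ℕ)) / u₁), Real.exp (-(u₁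 + u₂)) / (1 - Real.exp (-(u₁ + u₂))) ^ (2 : ℕ) * Real.log u₂ ^ (4 : ℕ)) - (Real.log (Q ^ (2 : ℕ) / ((g * g * (k₁ * k₂) : ℕ) : ℝ)) ^ (5 : ℕ) / 160 + μ₂ * Real.log (Q ^ (2 : ℕ) / ((g * g * (k₁ * k₂) : ℕ) : ℝ)) ^ (3 : ℕ) + 2 * μ₄ * Real.log (Q ^ (2 : ℕ) / ((g * g * (k₁ * k₂) : ℕ) : ℝ)) + E₀₄)) +
            ((2 * (Real.log Q - Real.log g) - Real.log k₁ - Real.log k₂) ^ (7 : ℕ) - 3 * (2 * (Real.log Q - Real.log g) - Real.log k₁ - Real.log k₂) ^ (5 : ℕ) * ((∑ p ∈ k₁.primeFactors, Real.log p ^ (2 : ℕ)) + ∑ p ∈ k₂.primeFactors, Real.log p ^ (2 : ℕ)) + 9 * (2 * (Real.log Q - Real.log g) - Real.log k₁ - Real.log k₂) ^ (3 : ℕ) * ((∑ p ∈ k₁.primeFactors, Real.log p ^ (2 : ℕ)) + ∑ p ∈ k₂.primeFactors, Real.log p ^ (2 : ℕ)) ^ (2 : ℕ) - 15 * (2 *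 (Real.log Q - Real.log g) - Real.log k₁ - Real.log k₂) * ((∑ p ∈ k₁.primeFactors, Real.log p ^ (2 : ℕ)) + ∑ p ∈ k₂.primeFactors, Real.log p ^ (2 : ℕ)) ^ (3 : ℕ) - 6 * (2 * (Real.log Q - Real.log g) - Real.log k₁ - Real.log k₂) ^ (3 : ℕ) * ((∑ p ∈ k₁.primeFactors, Real.log p ^ (4 : ℕ)) + ∑ p ∈ k₂.primeFactors, Real.log p ^ (4 : ℕ)) + 30 * (2 * (Real.log Q - Real.log g) - Real.log k₁ - Real.log k₂) * ((∑ p ∈ k₁.primeFactors, Real.log p ^ (2 : ℕ)) + ∑ p ∈ k₂.primeFactors, Real.log p ^ (2 : ℕ)) *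
            ((∑ p ∈ k₁.primeFactors, Real.log p ^ (4 : ℕ)) + ∑ p ∈ k₂.primeFactors, Real.log p ^ (4 : ℕ)) - 16 * (2 * (Real.log Q - Real.log g) - Real.log k₁ - Real.log k₂) * ((∑ p ∈ k₁.primeFactors, Real.log p ^ (6 : ℕ)) + ∑ p ∈ k₂.primeFactors, Real.log p ^ (6 : ℕ))) / 32 * ((∫ u₁ in Ioi (0 : ℝ), Real.log u₁ * ∫ u₂ in Ioi ((((g * g * (k₁ * k₂) : ℕ) : ℝ) / Q ^ (2 : ℕ)) / u₁), Real.exp (-(u₁ + u₂)) / (1 - Real.exp (-(u₁ + u₂))) ^ (2 : ℕ)) - (-(Real.log (Q ^ (2 : ℕ) / ((g * g * (k₁ * k₂) : ℕ) : ℝ)) ^ (2 : ℕ)) / 8 + E₁₀)) +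
            ((2 * (Real.log Q - Real.log g) - Real.log k₁ - Real.log k₂) ^ (6 : ℕ) - 3 * (2 * (Real.log Q - Real.log g) - Real.log k₁ - Real.log k₂) ^ (4 : ℕ) * ((∑ p ∈ k₁.primeFactors, Real.log p ^ (2 : ℕ)) + ∑ p ∈ k₂.primeFactors, Real.log p ^ (2 : ℕ)) + 9 * (2 * (Real.log Q - Real.log g) - Real.log k₁ - Real.log k₂) ^ (2 : ℕ) * ((∑ p ∈ k₁.primeFactors, Real.log p ^ (2 : ℕ)) + ∑ p ∈ k₂.primeFactors, Real.log p ^ (2 : ℕ)) ^ (2 : ℕ) - 6 * (2 * (Real.log Q - Real.log g) - Real.log k₁ - Real.log k₂) ^ (2 : ℕ) * ((∑ p ∈ k₁.primeFactors, Real.log p ^ (4 : ℕ)) + ∑ p ∈ k₂.primeFactors, Real.log p ^ (4 : ℕ)) - 15 * ((∑ p ∈ k₁.primeFactors, Real.log p ^ (2 : ℕ)) + ∑ p ∈ k₂.primeFactors, Real.log p ^ (2 : ℕ)) ^ (3 : ℕ) + 30 * ((∑ p ∈ k₁.primeFactors, Real.log p ^ (2 : ℕ)) + ∑ p ∈ k₂.primeFactors,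 Real.log p ^ (2 : ℕ)) * ((∑ p ∈ k₁.primeFactors, Real.log p ^ (4 : ℕ)) + ∑ p ∈ k₂.primeFactors, Real.log p ^ (4 : ℕ)) - 16 *
            ((∑ p ∈ k₁.primeFactors, Real.log p ^ (6 : ℕ)) + ∑ p ∈ k₂.primeFactors, Real.log p ^ (6 : ℕ))) / 4 * ((∫ u₁ in Ioi (0 : ℝ), Real.log u₁ * ∫ u₂ in Ioi ((((g * g * (k₁ * k₂) : ℕ) : ℝ) / Q ^ (2 : ℕ)) / u₁), Real.exp (-(u₁ + u₂)) / (1 - Real.exp (-(u₁ + u₂))) ^ (2 : ℕ) * Real.log u₂) - (Real.log (Q ^ (2 : ℕ) / ((g * g * (k₁ * k₂) : ℕ) : ℝ)) ^ (3 : ℕ) / 24 - 2 * μ₂ * Real.log (Q ^ (2 : ℕ) / ((g * g * (k₁ * k₂) : ℕ) : ℝ)) + E₁₁)) +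
            (3 * (2 * (Real.log Q - Real.log g) - Real.log k₁ - Real.log k₂) ^ (5 : ℕ) - 6 * (2 * (Real.log Q - Real.log g) - Real.log k₁ - Real.log k₂) ^ (3 : ℕ) * ((∑ p ∈ k₁.primeFactors, Real.log p ^ (2 : ℕ)) + ∑ p ∈ k₂.primeFactors, Real.log p ^ (2 : ℕ)) + 9 * (2 * (Real.log Q - Real.log g) - Real.log k₁ - Real.log k₂) * ((∑ p ∈ k₁.primeFactors, Real.log p ^ (2 : ℕ)) + ∑ p ∈ k₂.primeFactors, Real.log p ^ (2 : ℕ)) ^ (2 : ℕ) - 6 * (2 * (Real.log Q - Real.log g) - Real.log k₁ - Real.log k₂) * ((∑ p ∈ k₁.primeFactors, Real.log p ^ (4 : ℕ)) + ∑ p ∈ k₂.primeFactors, Real.log p ^ (4 : ℕ))) / 4 * ((∫ u₁ in Ioi (0 : ℝ), Real.log u₁ * ∫ u₂ in Ioi ((((g * g * (k₁ * k₂) : ℕ) : ℝ) / Q ^ (2 : ℕ)) / u₁), Real.exp (-(u₁ + u₂)) / (1 - Real.exp (-(u₁ + u₂))) ^ (2 : ℕ) * Real.log u₂ ^ (2 :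 ℕ)) - (-(Real.log (Q ^ (2 : ℕ) / ((g * g * (k₁ * k₂) : ℕ) : ℝ)) ^ (4 : ℕ)) / 64 + μ₂ / 2 * Real.log (Q ^ (2 : ℕ) / ((g * g * (k₁ * k₂) : ℕ) : ℝ)) ^ (2 : ℕ) + E₁₂)) +
            ((2 * (Real.log Q - Real.log g) - Real.log k₁ - Real.log k₂) ^ (4 : ℕ) - 3 * ((∑ p ∈ k₁.primeFactors, Real.log p ^ (2 : ℕ)) + ∑ p ∈ k₂.primeFactors, Real.log p ^ (2 : ℕ)) ^ (2 : ℕ) + 2 * ((∑ p ∈ k₁.primeFactors, Real.log p ^ (4 : ℕ)) + ∑ p ∈ k₂.primeFactors, Real.log p ^ (4 : ℕ))) * ((∫ u₁ in Ioi (0 : ℝ), Real.log u₁ * ∫ u₂ in Ioi ((((g * g * (k₁ * k₂) : ℕ) : ℝ) / Q ^ (2 : ℕ)) / u₁), Real.exp (-(u₁ + u₂)) / (1 - Real.exp (-(u₁ + u₂))) ^ (2 : ℕ) * Real.log u₂ ^ (3 : ℕ)) - (Real.log (Q ^ (2 : ℕ) / ((g * g * (k₁ * k₂) : ℕ) : ℝ))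 ^ (5 : ℕ) / 160 - 2 * μ₄ * Real.log (Q ^ (2 : ℕ) / ((g * g * (k₁ * k₂) : ℕ) : ℝ)) + E₁₃)) +
            ((2 * (Real.log Q - Real.log g) - Real.log k₁ - Real.log k₂) ^ (3 : ℕ) + 3 * (2 * (Real.log Q - Real.log g) - Real.log k₁ - Real.log k₂) * ((∑ p ∈ k₁.primeFactors, Real.log p ^ (2 : ℕ)) + ∑ p ∈ k₂.primeFactors, Real.log p ^ (2 : ℕ))) / 2 * ((∫ u₁ in Ioi (0 : ℝ), Real.log u₁ * ∫ u₂ in Ioi ((((g * g * (k₁ * k₂) : ℕ) : ℝ) / Q ^ (2 : ℕ)) / u₁), Real.exp (-(u₁ + u₂)) / (1 - Real.exp (-(u₁ + u₂))) ^ (2 : ℕ) * Real.log u₂ ^ (4 : ℕ)) - (-(Real.log (Q ^ (2 : ℕ) / ((g * g * (k₁ * k₂) : ℕ) : ℝ)) ^ (6 : ℕ)) / 384 - μ₂ / 8 * Real.log (Q ^ (2 : ℕ) / ((g * g * (k₁ * k₂) : ℕ) : ℝ)) ^ (4 : ℕ) + 3 * μ₄ / 2 * Real.log (Q ^ (2 :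 ℕ) / ((g * g * (k₁ * k₂) : ℕ) : ℝ)) ^ (2 : ℕ) + E₁₄)) +
            (3 * (2 * (Real.log Q - Real.log g) - Real.log k₁ - Real.log k₂) ^ (6 : ℕ) - 3 * (2 * (Real.log Q - Real.log g) - Real.log k₁ - Real.log k₂) ^ (4 : ℕ) * ((∑ p ∈ k₁.primeFactors, Real.log p ^ (2 : ℕ)) + ∑ p ∈ k₂.primeFactors, Real.log p ^ (2 : ℕ)) - 9 * (2 * (Real.log Q - Real.log g) - Real.log k₁ - Real.log k₂) ^ (2 : ℕ) * ((∑ p ∈ k₁.primeFactors, Real.log p ^ (2 : ℕ)) + ∑ p ∈ k₂.primeFactors, Real.log p ^ (2 : ℕ)) ^ (2 : ℕ) + 6 * (2 * (Real.log Q - Real.log g) - Real.log k₁ - Real.log k₂) ^ (2 : ℕ) * ((∑ p ∈ k₁.primeFactors, Real.log p ^ (4 : ℕ)) + ∑ p ∈ k₂.primeFactors, Real.log p ^ (4 : ℕ)) + 45 * ((∑ p ∈ k₁.primeFactors, Real.log p ^ (2 : ℕ)) + ∑ p ∈ k₂.primeFactors, Real.log p ^ (2 : ℕ)) ^ (3 :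 ℕ) - 90 * ((∑ p ∈ k₁.primeFactors, Real.log p ^ (2 : ℕ)) + ∑ p ∈ k₂.primeFactors, Real.log p ^ (2 : ℕ)) * ((∑ p ∈ k₁.primeFactors, Real.log p ^ (4 : ℕ)) + ∑ p ∈ k₂.primeFactors, Real.log p ^ (4 : ℕ)) + 48 *
            ((∑ p ∈ k₁.primeFactors, Real.log p ^ (6 : ℕ)) + ∑ p ∈ k₂.primeFactors, Real.log p ^ (6 : ℕ))) / 32 * ((∫ u₁ in Ioi (0 : ℝ), Real.log u₁ ^ (2 : ℕ) * ∫ u₂ in Ioi ((((g * g * (k₁ * k₂) : ℕ) : ℝ) / Q ^ (2 : ℕ)) / u₁), Real.exp (-(u₁ + u₂)) / (1 - Real.exp (-(u₁ + u₂))) ^ (2 : ℕ)) - (Real.log (Q ^ (2 : ℕ) / ((g * g * (k₁ * k₂) : ℕ) : ℝ)) ^ (3 : ℕ) / 24 + 2 * μ₂ * Real.log (Q ^ (2 : ℕ) / ((g * g * (k₁ * k₂) : ℕ) : ℝ)) + E₂₀)) +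
            (3 * (2 * (Real.log Q - Real.log g) - Real.log k₁ - Real.log k₂) ^ (5 : ℕ) - 6 * (2 * (Real.log Q - Real.log g) - Real.log k₁ - Real.log k₂) ^ (3 : ℕ) * ((∑ p ∈ k₁.primeFactors, Real.log p ^ (2 : ℕ)) + ∑ p ∈ k₂.primeFactors, Real.log p ^ (2 : ℕ)) + 9 * (2 * (Real.log Q - Real.log g) - Real.log k₁ - Real.log k₂) * ((∑ p ∈ k₁.primeFactors, Real.log p ^ (2 : ℕ)) + ∑ p ∈ k₂.primeFactors, Real.log p ^ (2 : ℕ)) ^ (2 : ℕ) - 6 * (2 * (Real.log Q - Real.log g) - Real.log k₁ - Real.log k₂) * ((∑ p ∈ k₁.primeFactors, Real.log p ^ (4 : ℕ)) + ∑ p ∈ k₂.primeFactors, Real.log p ^ (4 : ℕ))) / 4 * ((∫ u₁ in Ioi (0 : ℝ), Real.log u₁ ^ (2 : ℕ) * ∫ u₂ in Ioi ((((g * g * (k₁ * k₂) : ℕ) : ℝ) / Q ^ (2 : ℕ)) / u₁), Real.exp (-(u₁ + u₂)) / (1 - Real.exp (-(u₁ + u₂))) ^ (2 : ℕ) * Real.log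 u₂) - (-(Real.log (Q ^ (2 : ℕ) / ((g * g * (k₁ * k₂) : ℕ) : ℝ)) ^ (4 : ℕ)) / 64 + μ₂ / 2 * Real.log (Q ^ (2 : ℕ) / ((g * g * (k₁ * k₂) : ℕ) : ℝ)) ^ (2 : ℕ) + E₂₁)) +
            (9 * (2 * (Real.log Q - Real.log g) - Real.log k₁ - Real.log k₂) ^ (4 : ℕ) - 18 * (2 * (Real.log Q - Real.log g) - Real.log k₁ - Real.log k₂) ^ (2 : ℕ) * ((∑ p ∈ k₁.primeFactors, Real.log p ^ (2 : ℕ)) + ∑ p ∈ k₂.primeFactors, Real.log p ^ (2 : ℕ)) + 27 * ((∑ p ∈ k₁.primeFactors, Real.log p ^ (2 : ℕ)) + ∑ p ∈ k₂.primeFactors, Real.log p ^ (2 : ℕ)) ^ (2 : ℕ) - 18 * ((∑ p ∈ k₁.primeFactors, Real.log p ^ (4 : ℕ)) + ∑ p ∈ k₂.primeFactors, Real.log p ^ (4 : ℕ))) / 4 * ((∫ u₁ in Ioi (0 : ℝ), Real.log u₁ ^ (2 : ℕ) * ∫ u₂ in Ioi ((((g * g * (k₁ * k₂) : ℕ) :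 ℝ) / Q ^ (2 : ℕ)) / u₁), Real.exp (-(u₁ + u₂)) / (1 - Real.exp (-(u₁ + u₂))) ^ (2 : ℕ) * Real.log u₂ ^ (2 : ℕ)) - (Real.log (Q ^ (2 : ℕ) / ((g * g * (k₁ * k₂) : ℕ) : ℝ)) ^ (5 : ℕ) / 160 - μ₂ / 3 * Real.log (Q ^ (2 : ℕ) / ((g * g * (k₁ * k₂) : ℕ) : ℝ)) ^ (3 : ℕ) + 2 * μ₄ * Real.log (Q ^ (2 : ℕ) / ((g * g * (k₁ * k₂) : ℕ) : ℝ)) + E₂₂)) +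
            (3 * (2 * (Real.log Q - Real.log g) - Real.log k₁ - Real.log k₂) ^ (3 : ℕ) - 3 * (2 * (Real.log Q - Real.log g) - Real.log k₁ - Real.log k₂) * ((∑ p ∈ k₁.primeFactors, Real.log p ^ (2 : ℕ)) + ∑ p ∈ k₂.primeFactors, Real.log p ^ (2 : ℕ))) * ((∫ u₁ in Ioi (0 : ℝ), Real.log u₁ ^ (2 : ℕ) * ∫ u₂ in Ioi ((((g * g * (k₁ * k₂) : ℕ) : ℝ) / Q ^ (2 : ℕ)) / u₁), Real.exp (-(u₁ + u₂)) / (1 - Real.exp (-(u₁ + u₂))) ^ (2 : ℕ) * Real.log u₂ ^ (3 : ℕ)) - (-(Real.log (Q ^ (2 : ℕ) / ((g * g * (k₁ * k₂) : ℕ) : ℝ)) ^ (6 : ℕ)) / 384 + μ₂ / 8 * Real.log (Q ^ (2 : ℕ) / ((g * g * (k₁ * k₂) : ℕ) : ℝ)) ^ (4 : ℕ) - μ₄ / 2 * Real.log (Q ^ (2 : ℕ) / ((g * g * (k₁ * k₂) : ℕ) : ℝ)) ^ (2 : ℕ) + E₂₃)) +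
            (3 * (2 * (Real.log Q - Real.log g) - Real.log k₁ - Real.log k₂) ^ (2 : ℕ) + 3 * ((∑ p ∈ k₁.primeFactors, Real.log p ^ (2 : ℕ)) + ∑ p ∈ k₂.primeFactors, Real.log p ^ (2 : ℕ))) / 2 * ((∫ u₁ in Ioi (0 : ℝ), Real.log u₁ ^ (2 : ℕ) * ∫ u₂ in Ioi ((((g * g * (k₁ * k₂) : ℕ) : ℝ) / Q ^ (2 : ℕ)) / u₁), Real.exp (-(u₁ + u₂)) / (1 - Real.exp (-(u₁ + u₂))) ^ (2 : ℕ) * Real.log u₂ ^ (4 : ℕ)) - (Real.log (Q ^ (2 : ℕ) / ((g * g * (k₁ * k₂) : ℕ) : ℝ)) ^ (7 : ℕ) / 896 - μ₂ / 40 * Real.log (Q ^ (2 : ℕ) / ((g * g * (k₁ * k₂) : ℕ) : ℝ)) ^ (5 : ℕ) - μ₄ / 6 * Real.log (Q ^ (2 : ℕ) / ((g * g * (k₁ * k₂) : ℕ) : ℝ)) ^ (3 : ℕ) + 2 * μ₆ * Real.log (Q ^ (2 : ℕ) / ((g * g * (k₁ * k₂) : ℕ) : ℝ)) + E₂₄))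 +
            ((2 * (Real.log Q - Real.log g) - Real.log k₁ - Real.log k₂) ^ (5 : ℕ) + 2 * (2 * (Real.log Q - Real.log g) - Real.log k₁ - Real.log k₂) ^ (3 : ℕ) * ((∑ p ∈ k₁.primeFactors, Real.log p ^ (2 : ℕ)) + ∑ p ∈ k₂.primeFactors, Real.log p ^ (2 : ℕ)) - 9 * (2 * (Real.log Q - Real.log g) - Real.log k₁ - Real.log k₂) * ((∑ p ∈ k₁.primeFactors, Real.log p ^ (2 : ℕ)) + ∑ p ∈ k₂.primeFactors, Real.log p ^ (2 : ℕ)) ^ (2 : ℕ) + 6 * (2 * (Real.log Q - Real.log g) - Real.log k₁ - Real.log k₂) * ((∑ p ∈ k₁.primeFactors, Real.log p ^ (4 : ℕ)) + ∑ p ∈ k₂.primeFactors, Real.log p ^ (4 : ℕ))) / 8 * ((∫ u₁ in Ioi (0 : ℝ), Real.log u₁ ^ (3 : ℕ) * ∫ u₂ in Ioi ((((g * g * (k₁ * k₂) : ℕ) : ℝ) / Q ^ (2 : ℕ)) / u₁), Real.exp (-(u₁ + u₂)) / (1 - Real.exp (-(u₁ + u₂))) ^ (2 : ℕ)) - (-(Real.log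 (Q ^ (2 : ℕ) / ((g * g * (k₁ * k₂) : ℕ) : ℝ)) ^ (4 : ℕ)) / 64 - 3 * μ₂ / 2 * Real.log (Q ^ (2 : ℕ) / ((g * g * (k₁ * k₂) : ℕ) : ℝ)) ^ (2 : ℕ) + E₃₀)) +
            ((2 * (Real.log Q - Real.log g) - Real.log k₁ - Real.log k₂) ^ (4 : ℕ) - 3 * ((∑ p ∈ k₁.primeFactors, Real.log p ^ (2 : ℕ)) + ∑ p ∈ k₂.primeFactors, Real.log p ^ (2 : ℕ)) ^ (2 : ℕ) + 2 * ((∑ p ∈ k₁.primeFactors, Real.log p ^ (4 : ℕ)) + ∑ p ∈ k₂.primeFactors, Real.log p ^ (4 : ℕ))) * ((∫ u₁ in Ioi (0 : ℝ), Real.log u₁ ^ (3 : ℕ) * ∫ u₂ in Ioi ((((g * g * (k₁ * k₂) : ℕ) : ℝ) / Q ^ (2 : ℕ)) / u₁), Real.exp (-(u₁ + u₂)) / (1 - Real.exp (-(u₁ + u₂))) ^ (2 : ℕ) * Real.log u₂) - (Real.log (Q ^ (2 : ℕ) / ((g * g * (k₁ * k₂) : ℕ) : ℝ)) ^ (5 :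 ℕ) / 160 - 2 * μ₄ * Real.log (Q ^ (2 : ℕ) / ((g * g * (k₁ * k₂) : ℕ) : ℝ)) + E₃₁)) +
            (3 * (2 * (Real.log Q - Real.log g) - Real.log k₁ - Real.log k₂) ^ (3 : ℕ) - 3 * (2 * (Real.log Q - Real.log g) - Real.log k₁ - Real.log k₂) * ((∑ p ∈ k₁.primeFactors, Real.log p ^ (2 : ℕ)) + ∑ p ∈ k₂.primeFactors, Real.log p ^ (2 : ℕ))) * ((∫ u₁ in Ioi (0 : ℝ), Real.log u₁ ^ (3 : ℕ) * ∫ u₂ in Ioi ((((g * g * (k₁ * k₂) : ℕ) : ℝ) / Q ^ (2 : ℕ)) / u₁), Real.exp (-(u₁ + u₂)) / (1 - Real.exp (-(u₁ + u₂))) ^ (2 : ℕ) * Real.log u₂ ^ (2 : ℕ)) - (-(Real.log (Q ^ (2 : ℕ) / ((g * g * (k₁ * k₂) : ℕ) : ℝ)) ^ (6 : ℕ)) / 384 + μ₂ / 8 * Real.log (Q ^ (2 : ℕ) / ((g * g * (k₁ * k₂) : ℕ) : ℝ)) ^ (4 : ℕ) - μ₄ / 2 * Real.log (Q ^ (2 :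 ℕ) / ((g * g * (k₁ * k₂) : ℕ) : ℝ)) ^ (2 : ℕ) + E₃₂)) +
            (4 * (2 * (Real.log Q - Real.log g) - Real.log k₁ - Real.log k₂) ^ (2 : ℕ) - 4 * ((∑ p ∈ k₁.primeFactors, Real.log p ^ (2 : ℕ)) + ∑ p ∈ k₂.primeFactors, Real.log p ^ (2 : ℕ))) * ((∫ u₁ in Ioi (0 : ℝ), Real.log u₁ ^ (3 : ℕ) * ∫ u₂ in Ioi ((((g * g * (k₁ * k₂) : ℕ) : ℝ) / Q ^ (2 : ℕ)) / u₁), Real.exp (-(u₁ + u₂)) / (1 - Real.exp (-(u₁ + u₂))) ^ (2 : ℕ) * Real.log u₂ ^ (3 : ℕ)) - (Real.log (Q ^ (2 : ℕ) / ((g * g * (k₁ * k₂) : ℕ) : ℝ)) ^ (7 : ℕ) / 896 - 3 * μ₂ / 40 * Real.log (Q ^ (2 : ℕ) / ((g * g * (k₁ * k₂) : ℕ) : ℝ)) ^ (5 : ℕ) + μ₄ / 2 * Real.log (Q ^ (2 : ℕ) / ((g * g * (k₁ * k₂) : ℕ) : ℝ)) ^ (3 : ℕ) - 2 * μ₆ *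 Real.log (Q ^ (2 : ℕ) / ((g * g * (k₁ * k₂) : ℕ) : ℝ)) + E₃₃)) +
            2 * (2 * (Real.log Q - Real.log g) - Real.log k₁ - Real.log k₂) * ((∫ u₁ in Ioi (0 : ℝ), Real.log u₁ ^ (3 : ℕ) * ∫ u₂ in Ioi ((((g * g * (k₁ * k₂) : ℕ) : ℝ) / Q ^ (2 : ℕ)) / u₁), Real.exp (-(u₁ + u₂)) / (1 - Real.exp (-(u₁ + u₂))) ^ (2 : ℕ) * Real.log u₂ ^ (4 : ℕ)) - (-(Real.log (Q ^ (2 : ℕ) / ((g * g * (k₁ * k₂) : ℕ) : ℝ)) ^ (8 : ℕ)) / 2048 + μ₂ / 32 * Real.log (Q ^ (2 : ℕ) / ((g * g * (k₁ * k₂) : ℕ) : ℝ)) ^ (6 : ℕ) - 3 * μ₄ / 16 * Real.log (Q ^ (2 : ℕ) / ((g * g * (k₁ * k₂) : ℕ) : ℝ)) ^ (4 : ℕ) + μ₆ / 2 * Real.log (Q ^ (2 : ℕ) / ((g * g * (k₁ * k₂) : ℕ) : ℝ)) ^ (2 : ℕ) + E₃₄)) +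
            ((2 * (Real.log Q - Real.log g) - Real.log k₁ - Real.log k₂) ^ (4 : ℕ) + 6 * (2 * (Real.log Q - Real.log g) - Real.log k₁ - Real.log k₂) ^ (2 : ℕ) * ((∑ p ∈ k₁.primeFactors, Real.log p ^ (2 : ℕ)) + ∑ p ∈ k₂.primeFactors, Real.log p ^ (2 : ℕ)) + 3 * ((∑ p ∈ k₁.primeFactors, Real.log p ^ (2 : ℕ)) + ∑ p ∈ k₂.primeFactors, Real.log p ^ (2 : ℕ)) ^ (2 : ℕ) - 2 * ((∑ p ∈ k₁.primeFactors, Real.log p ^ (4 : ℕ)) + ∑ p ∈ k₂.primeFactors, Real.log p ^ (4 : ℕ))) / 16 * ((∫ u₁ in Ioi (0 : ℝ), Real.log u₁ ^ (4 : ℕ) * ∫ u₂ in Ioi ((((g * g * (k₁ * k₂) : ℕ) : ℝ) / Q ^ (2 : ℕ)) / u₁), Real.exp (-(u₁ + u₂)) / (1 - Real.exp (-(u₁ + u₂))) ^ (2 : ℕ)) - (Real.log (Q ^ (2 : ℕ) / ((g * g * (k₁ * k₂) : ℕ) : ℝ)) ^ (5 : ℕ) / 160 + μ₂ * Real.log (Q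 ^ (2 : ℕ) / ((g * g * (k₁ * k₂) : ℕ) : ℝ)) ^ (3 : ℕ) + 2 * μ₄ * Real.log (Q ^ (2 : ℕ) / ((g * g * (k₁ * k₂) : ℕ) : ℝ)) + E₄₀)) +
            ((2 * (Real.log Q - Real.log g) - Real.log k₁ - Real.log k₂) ^ (3 : ℕ) + 3 * (2 * (Real.log Q - Real.log g) - Real.log k₁ - Real.log k₂) * ((∑ p ∈ k₁.primeFactors, Real.log p ^ (2 : ℕ)) + ∑ p ∈ k₂.primeFactors, Real.log p ^ (2 : ℕ))) / 2 * ((∫ u₁ in Ioi (0 : ℝ), Real.log u₁ ^ (4 : ℕ) * ∫ u₂ in Ioi ((((g * g * (k₁ * k₂) : ℕ) : ℝ) / Q ^ (2 : ℕ)) / u₁), Real.exp (-(u₁ + u₂)) / (1 - Real.exp (-(u₁ + u₂))) ^ (2 : ℕ) * Real.log u₂) - (-(Real.log (Q ^ (2 : ℕ) / ((g * g * (k₁ * k₂) : ℕ) : ℝ)) ^ (6 : ℕ)) / 384 - μ₂ / 8 * Real.log (Q ^ (2 : ℕ) / ((g * g * (k₁ * k₂) : ℕ) : ℝ)) ^ (4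 : ℕ) + 3 * μ₄ / 2 * Real.log (Q ^ (2 : ℕ) / ((g * g * (k₁ * k₂) : ℕ) : ℝ)) ^ (2 : ℕ) + E₄₁)) +
            (3 * (2 * (Real.log Q - Real.log g) - Real.log k₁ - Real.log k₂) ^ (2 : ℕ) + 3 * ((∑ p ∈ k₁.primeFactors, Real.log p ^ (2 : ℕ)) + ∑ p ∈ k₂.primeFactors, Real.log p ^ (2 : ℕ))) / 2 * ((∫ u₁ in Ioi (0 : ℝ), Real.log u₁ ^ (4 : ℕ) * ∫ u₂ in Ioi ((((g * g * (k₁ * k₂) : ℕ) : ℝ) / Q ^ (2 : ℕ)) / u₁), Real.exp (-(u₁ + u₂)) / (1 - Real.exp (-(u₁ + u₂))) ^ (2 : ℕ) * Real.log u₂ ^ (2 : ℕ)) - (Real.log (Q ^ (2 : ℕ) / ((g * g * (k₁ * k₂) : ℕ) : ℝ)) ^ (7 : ℕ) / 896 - μ₂ / 40 * Real.log (Q ^ (2 : ℕ) / ((g * g * (k₁ * k₂) : ℕ) : ℝ)) ^ (5 : ℕ) - μ₄ / 6 * Real.log (Q ^ (2 : ℕ) / ((g * g * (k₁ * k₂)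 : ℕ) : ℝ)) ^ (3 : ℕ) + 2 * μ₆ * Real.log (Q ^ (2 : ℕ) / ((g * g * (k₁ * k₂) : ℕ) : ℝ)) + E₄₂)) +
            2 * (2 * (Real.log Q - Real.log g) - Real.log k₁ - Real.log k₂) * ((∫ u₁ in Ioi (0 : ℝ), Real.log u₁ ^ (4 : ℕ) * ∫ u₂ in Ioi ((((g * g * (k₁ * k₂) : ℕ) : ℝ) / Q ^ (2 : ℕ)) / u₁), Real.exp (-(u₁ + u₂)) / (1 - Real.exp (-(u₁ + u₂))) ^ (2 : ℕ) * Real.log u₂ ^ (3 : ℕ)) - (-(Real.log (Q ^ (2 : ℕ) / ((g * g * (k₁ * k₂) : ℕ) : ℝ)) ^ (8 : ℕ)) / 2048 + μ₂ / 32 * Real.log (Q ^ (2 : ℕ) / ((g * g * (k₁ * k₂) : ℕ) : ℝ)) ^ (6 : ℕ) - 3 * μ₄ / 16 * Real.log (Q ^ (2 : ℕ) / ((g * g * (k₁ * k₂) : ℕ) : ℝ)) ^ (4 : ℕ) + μ₆ / 2 * Real.log (Q ^ (2 : ℕ) / ((g * g * (k₁ * k₂) : ℕ) : ℝ)) ^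 (2 : ℕ) + E₄₃)) +
            ((∫ u₁ in Ioi (0 : ℝ), Real.log u₁ ^ (4 : ℕ) * ∫ u₂ in Ioi ((((g * g * (k₁ * k₂) : ℕ) : ℝ) / Q ^ (2 : ℕ)) / u₁), Real.exp (-(u₁ + u₂)) / (1 - Real.exp (-(u₁ + u₂))) ^ (2 : ℕ) * Real.log u₂ ^ (4 : ℕ)) - (Real.log (Q ^ (2 : ℕ) / ((g * g * (k₁ * k₂) : ℕ) : ℝ)) ^ (9 : ℕ) / 4608 - μ₂ / 56 * Real.log (Q ^ (2 : ℕ) / ((g * g * (k₁ * k₂) : ℕ) : ℝ)) ^ (7 : ℕ) + 3 * μ₄ / 20 * Real.log (Q ^ (2 : ℕ) / ((g * g * (k₁ * k₂) : ℕ) : ℝ)) ^ (5 : ℕ) - 2 * μ₆ / 3 * Real.log (Q ^ (2 : ℕ) / ((g * g * (k₁ * k₂) : ℕ) : ℝ)) ^ (3 : ℕ) + 2 * μ₈ * Real.log (Q ^ (2 : ℕ) / ((g * g * (k₁ * k₂) : ℕ) : ℝ)) + E₄₄)))| ≤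
      C * divWeight n ^ 2 *
        ((1 + 2 * Real.log M + Real.log Q) ^ 20 * Real.sqrt (2 * ((g : ℝ) ^ 2 / Q ^ 2) * K₁ * (M / n)) +
          (1 + 2 * Real.log M + Real.log Q) ^ 20 / (1 + Real.log K₁) ^ 16) := by
  obtain ⟨E₀₀, E₀₁, E₀₂, E₀₃, E₀₄, E₁₀, E₁₁, E₁₂, E₁₃, E₁₄, E₂₀, E₂₁, E₂₂, E₂₃, E₂₄, E₃₀, E₃₁, E₃₂, E₃₃, E₃₄, E₄₀, E₄₁, E₄₂, E₄₃, E₄₄, C₀, K, hC₀, hK, hI⟩ :=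
    abs_inner_rem_le₄₄ 16
  refine ⟨E₀₀, E₀₁, E₀₂, E₀₃, E₀₄, E₁₀, E₁₁, E₁₂, E₁₃, E₁₄, E₂₀, E₂₁, E₂₂, E₂₃, E₂₄, E₃₀, E₃₁, E₃₂, E₃₃, E₃₄, E₄₀, E₄₁, E₄₂, E₄₃, E₄₄, (∫ v in Set.Ioc (0 : ℝ) 1, Real.log v ^ 2 * (v / (1 + v ^ 2) ^ 2)),
    (∫ v in Set.Ioc (0 : ℝ) 1, Real.log v ^ 4 * (v / (1 + v ^ 2) ^ 2)), (∫ v in Set.Ioc (0 : ℝ) 1, Real.log v ^ 6 * (v / (1 + v ^ 2) ^ 2)),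
    (∫ v in Set.Ioc (0 : ℝ) 1, Real.log v ^ 8 * (v / (1 + v ^ 2) ^ 2)), fun P hP0 ↦ ?_⟩
  set SP : ℝ := ∑ i ∈ Finset.range (P.natDegree + 1), |P.coeff i| with hSP
  have hSP0 : 0 ≤ SP := Finset.sum_nonneg fun i _ ↦ abs_nonneg _
  refine ⟨SP ^ 2 * (K * C₀) * 2 ^ 10 + 1, by positivity, fun n g hn hg Q M hQ2 hM2 hnM hgM K₁ hK₁ ↦ ?_⟩
  have hn0 : (0 : ℝ) < n := by exact_mod_cast Nat.pos_of_ne_zero hn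
  have hg0 : (0 : ℝ) < g := by exact_mod_cast Nat.pos_of_ne_zero hg
  have hg1 : (1 : ℝ) ≤ g := by exact_mod_cast Nat.one_le_iff_ne_zero.2 hg
  have hQ0 : 0 < Q := by linarith
  have hM0 : 0 < M := by linarith
  set Y : ℝ := M / n with hYdef
  set L : ℝ := Real.log M with hLdef
  set α : ℝ := (g : ℝ) ^ 2 / Q ^ 2 with hαdef
  have hα : 0 < α := by positivity
  have hY : 1 ≤ Y := by rw [hYdef, le_div_iff₀ hn0]; linarith
  have hY0 : 0 < Y := by linarith only [hY]
  have hYM : Y ≤ M := div_le_self hM0.le (by exact_mod_cast Nat.one_le_iff_ne_zero.2 hn)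
  have hL0 : 0 < L := Real.log_pos (by linarith)
  have hLY0 : 0 ≤ Real.log Y := Real.log_nonneg hY
  have hLYL : Real.log Y ≤ L := Real.log_le_log hY0 hYM
  obtain ⟨hlogQ, hlogg0, hloggM⟩ : 0 ≤ Real.log Q ∧ 0 ≤ Real.log g ∧ Real.log g ≤ L :=
    ⟨Real.log_nonneg (by linarith), Real.log_nonneg hg1, Real.log_le_log hg0 hgM⟩
  set Lam : ℝ := 1 + 2 * Real.log M + Real.log Q with hLamdef
  have hLam1 : 1 ≤ Lam := by rw [hLamdef]; linarith
  have hLam0 : 0 < Lam := by linarith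
  set β : ℝ := Real.log Q - Real.log g - Real.log Y with hβdef
  have hβ : |β| ≤ Lam := by
    rw [hβdef, hLamdef, abs_le]; constructor <;> linarith
  have hLYLam : Real.log Y ≤ Lam := by rw [hLamdef]; linarith
  have hD0 : 0 ≤ divWeight n := divWeight_nonneg n
  have hxLam : 1 + |Real.log (2 * α * Y ^ 2)| ≤ 2 * Lam := by
    have hl2 : Real.log 2 < 1 := by have := Real.log_two_lt_d9; linarith
    have hl2' : 0 < Real.log 2 := Real.log_pos (by norm_num)
    have hlog : Real.log (2 * α * Y ^ 2) = Real.log 2 + (2 * Real.log g - 2 * Real.log Q) + 2 * Real.log Y := by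
      rw [hαdef, Real.log_mul (by positivity) (by positivity), Real.log_mul (by norm_num) (by positivity),
        Real.log_pow, Real.log_div (by positivity) (by positivity), Real.log_pow, Real.log_pow]
      push_cast; ring
    rw [hlog, hLamdef]
    have := abs_le.2 (⟨by linarith, by linarith⟩ :
      -(1 + 4 * Real.log M + 2 * Real.log Q) ≤ Real.log 2 + (2 * Real.log g - 2 * Real.log Q) + 2 * Real.log Y ∧
        Real.log 2 + (2 * Real.log g - 2 * Real.log Q) + 2 * Real.log Y ≤ 1 + 4 * Real.log M + 2 * Real.log Q)
    linarith
  have hx0 : 0 ≤ 1 + |Real.log (2 * α * Y ^ 2)| := by positivity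
  have hK0 : 0 ≤ Real.log (K₁ : ℝ) := Real.log_natCast_nonneg K₁
  have key := hI P hP0 n hn Y α β Lam L K₁ hY hα hK₁ hLam1 hβ hLYLam hL0 hLYL
  -- the three coordinate identities under the sum
  have hLk : ∀ k₁ ∈ Icc 1 ⌊Y⌋₊, ∀ k₂ ∈ Icc 1 ⌊Y⌋₊,
      2 * (Real.log Q - Real.log g) - Real.log k₁ - Real.log k₂ = 2 * β + ellp Y k₁ + ellp Y k₂ := by
    intro k₁ hk₁ k₂ hk₂
    have h1 : (0 : ℝ) < k₁ := by exact_mod_cast (Finset.mem_Icc.1 hk₁).1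
    have h2 : (0 : ℝ) < k₂ := by exact_mod_cast (Finset.mem_Icc.1 hk₂).1
    rw [ellp_eq_log hY0.le hk₁, ellp_eq_log hY0.le hk₂, Real.log_div hY0.ne' h1.ne', Real.log_div hY0.ne' h2.ne',
      hβdef]
    ring
  have hy : ∀ k₁ k₂ : ℕ, ((g * g * (k₁ * k₂) : ℕ) : ℝ) / Q ^ 2 = α * k₁ * k₂ := by
    intro k₁ k₂; rw [hαdef]; push_cast; ring
  have hlg : ∀ k₁ ∈ Icc 1 ⌊Y⌋₊, ∀ k₂ ∈ Icc 1 ⌊Y⌋₊,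
      Real.log (Q ^ 2 / ((g * g * (k₁ * k₂) : ℕ) : ℝ)) = Real.log (1 / (α * k₁ * k₂)) := by
    intro k₁ hk₁ k₂ hk₂
    have h1 : (0 : ℝ) < k₁ := by exact_mod_cast (Finset.mem_Icc.1 hk₁).1
    have h2 : (0 : ℝ) < k₂ := by exact_mod_cast (Finset.mem_Icc.1 hk₂).1
    congr 1
    rw [hαdef]; push_cast; field_simp
  refine le_trans (le_of_eq ?_) (key.trans ?_)
  · exact congrArg abs (Finset.sum_congr rfl fun k₁ hk₁ ↦ Finset.sum_congr rfl fun k₂ hk₂ ↦ by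
      simp only [hLk k₁ hk₁ k₂ hk₂, hy k₁ k₂, hlg k₁ hk₁ k₂ hk₂])
  -- the envelope: `Λ¹⁰(s + x¹⁰/K) ≤ (2¹⁰·…+1)·(Λ²⁰ s + Λ²⁰/K)`
  have hs0 : 0 ≤ Real.sqrt (2 * α * K₁ * Y) := Real.sqrt_nonneg _
  have hK16 : 0 < (1 + Real.log (K₁ : ℝ)) ^ 16 := by positivity
  have hx10 : (1 + |Real.log (2 * α * Y ^ 2)|) ^ 10 ≤ 2 ^ 10 * Lam ^ 10 := by
    rw [← mul_pow]; exact pow_le_pow_left₀ hx0 hxLam 10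
  have hLam10 : Lam ^ 10 ≤ Lam ^ 20 := pow_le_pow_right₀ hLam1 (by norm_num)
  have hL10 : 0 ≤ Lam ^ 10 := by positivity
  have hSK : 0 ≤ SP ^ 2 * (K * C₀) := by positivity
  have hD2 : 0 ≤ divWeight n ^ 2 := by positivity
  have hfin : SP ^ 2 * (K * C₀ * divWeight n ^ 2 * Lam ^ 10 *
      (Real.sqrt (2 * α * K₁ * Y) + (1 + |Real.log (2 * α * Y ^ 2)|) ^ 10 / (1 + Real.log K₁) ^ 16)) ≤
      (SP ^ 2 * (K * C₀) * 2 ^ 10 + 1) * divWeight n ^ 2 *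
        (Lam ^ 20 * Real.sqrt (2 * α * K₁ * Y) + Lam ^ 20 / (1 + Real.log K₁) ^ 16) := by
    have h1 : Lam ^ 10 * Real.sqrt (2 * α * K₁ * Y) ≤ 2 ^ 10 * (Lam ^ 20 * Real.sqrt (2 * α * K₁ * Y)) := by
      have := mul_le_mul_of_nonneg_right hLam10 hs0
      nlinarith [mul_nonneg (pow_nonneg hLam0.le 20) hs0]
    have h2 : Lam ^ 10 * (1 + |Real.log (2 * α * Y ^ 2)|) ^ 10 ≤ 2 ^ 10 * Lam ^ 20 := by
      calc Lam ^ 10 * (1 + |Real.log (2 * α * Y ^ 2)|) ^ 10 ≤ Lam ^ 10 * (2 ^ 10 * Lam ^ 10) :=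
            mul_le_mul_of_nonneg_left hx10 hL10
        _ = 2 ^ 10 * Lam ^ 20 := by ring
    have h3 : Lam ^ 10 * (Real.sqrt (2 * α * K₁ * Y) + (1 + |Real.log (2 * α * Y ^ 2)|) ^ 10 / (1 + Real.log K₁) ^ 16) ≤
        2 ^ 10 * (Lam ^ 20 * Real.sqrt (2 * α * K₁ * Y) + Lam ^ 20 / (1 + Real.log K₁) ^ 16) := by
      have h2' : Lam ^ 10 * (1 + |Real.log (2 * α * Y ^ 2)|) ^ 10 / (1 + Real.log K₁) ^ 16 ≤
          2 ^ 10 * Lam ^ 20 / (1 + Real.log K₁) ^ 16 := div_le_div_of_nonneg_right h2 hK16.le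
      calc Lam ^ 10 * (Real.sqrt (2 * α * K₁ * Y) + (1 + |Real.log (2 * α * Y ^ 2)|) ^ 10 / (1 + Real.log K₁) ^ 16)
          = Lam ^ 10 * Real.sqrt (2 * α * K₁ * Y) +
            Lam ^ 10 * (1 + |Real.log (2 * α * Y ^ 2)|) ^ 10 / (1 + Real.log K₁) ^ 16 := by ring
        _ ≤ 2 ^ 10 * (Lam ^ 20 * Real.sqrt (2 * α * K₁ * Y)) + 2 ^ 10 * Lam ^ 20 / (1 + Real.log K₁) ^ 16 :=
            add_le_add h1 h2'
        _ = 2 ^ 10 * (Lam ^ 20 * Real.sqrt (2 * α * K₁ * Y) + Lam ^ 20 / (1 + Real.log K₁) ^ 16) := by ring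
    have h4 : 0 ≤ Lam ^ 20 * Real.sqrt (2 * α * K₁ * Y) + Lam ^ 20 / (1 + Real.log K₁) ^ 16 := by positivity
    calc SP ^ 2 * (K * C₀ * divWeight n ^ 2 * Lam ^ 10 *
          (Real.sqrt (2 * α * K₁ * Y) + (1 + |Real.log (2 * α * Y ^ 2)|) ^ 10 / (1 + Real.log K₁) ^ 16))
        = SP ^ 2 * (K * C₀) * divWeight n ^ 2 * (Lam ^ 10 *
          (Real.sqrt (2 * α * K₁ * Y) + (1 + |Real.log (2 * α * Y ^ 2)|) ^ 10 / (1 + Real.log K₁) ^ 16)) := by ring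
      _ ≤ SP ^ 2 * (K * C₀) * divWeight n ^ 2 *
          (2 ^ 10 * (Lam ^ 20 * Real.sqrt (2 * α * K₁ * Y) + Lam ^ 20 / (1 + Real.log K₁) ^ 16)) :=
          mul_le_mul_of_nonneg_left h3 (mul_nonneg hSK hD2)
      _ = (SP ^ 2 * (K * C₀) * 2 ^ 10) * divWeight n ^ 2 *
          (Lam ^ 20 * Real.sqrt (2 * α * K₁ * Y) + Lam ^ 20 / (1 + Real.log K₁) ^ 16) := by ring
      _ ≤ (SP ^ 2 * (K * C₀) * 2 ^ 10 + 1) * divWeight n ^ 2 *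
          (Lam ^ 20 * Real.sqrt (2 * α * K₁ * Y) + Lam ^ 20 / (1 + Real.log K₁) ^ 16) := by
          gcongr; linarith
  simpa only [hSP] using hfin

end Summit.Parity.GeneralizedHardyLittlewood.Theorems.MomentsBeyondDiagonal.DiagCorner

end
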